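import Summits.ValiantsHypothesis.ValiantsHypothesis.Theorems.LacunarySymmetroidMatrixDescartesCensusDefiniteMiddleK3WalkEnds

/-!
# `MatrixDescartes` census — DOOR A, interior-definite-letter programme at `(2,3)`: FIVE ROOTS ARE SHARP
# (the sorted root list of a pencil `S₀ + x^d·1 + x^e·S₂` with five positive det-roots, gaps, alternation, end letters)

HONEST FRAMING.  Object-search cell `pub-symmetroid`, door-A seat `val-sym-door-p4` (gen 15); items stmt-ValiantsHypothesis-19979
`DoorA26` / 19980 `DoorA34` (OPEN, typed, never asserted); helper `--supports 19979`, NO closure claim.  Bookkeeping for the assembly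
of IDL(3) (`…CensusDefiniteMiddleK3Law`): nothing here bounds a root count by itself, decides `DoorA26`/`DoorA34`, or bears on
`MatrixDescartes` (stmt-ValiantsHypothesis-18050) / `VP ≠ VNP`.

**`five_roots_structure`.**  If `det(S₀ + X^d·1 + X^e·S₂)` (`S₀, S₂` real symmetric, `0 < d < e`) has at least five distinct
positive roots then (Descartes with multiplicity on six monomials: Mathlib `roots_countP_pos_le_signVariations` + the tree's
`signVariations_lt_card_support`) it has exactly five, all simple, `r 0 < ⋯ < r 4`; there is no other positive root; the
determinant alternates in sign across consecutive gap midpoints (`sign_flip_of_simple_root` + the intermediate value theorem);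
and all six monomials are present, in particular `det S₀ ≠ 0 ≠ det S₂`.

[folklore] Elementary.  Axioms standard; no definitions.
-/

-- the D-0017 layout repeats a namespace component (single-conjunct summit); the `dupNamespace` linter flags it; name mandated.
set_option linter.dupNamespace false

namespace Summit.ValiantsHypothesis.ValiantsHypothesis.Theorems.LacunarySymmetroidMatrixDescartes.Census.DefiniteMiddle

open Real Matrix Finset Polynomial
open scoped BigOperators

set_option maxHeartbeats 4000000 in
/-- **FIVE ROOTS ARE SHARP.**  For real symmetric `S₀, S₂` and `0 < d < e`, if the determinant of `S₀ + X^d·1 + X^e·S₂` has at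
least five distinct positive roots, then: they are exactly five, `r 0 < ⋯ < r 4`, there is no positive root below `r 0`, between
consecutive ones or above `r 4`, the determinant changes sign across each of them (products of values at consecutive gap
midpoints are negative), and the end letters are nonsingular (`det S₀ ≠ 0`, `det S₂ ≠ 0`). [folklore] -/
theorem five_roots_structure (S₀ S₂ : Matrix (Fin 2) (Fin 2) ℝ) (hS₀ : S₀.IsSymm) (hS₂ : S₂.IsSymm)
    {d e : ℕ} (hd : 0 < d) (hde : d < e)
    (h5' : 5 ≤ ((Matrix.det (S₀.map C + (X : ℝ[X]) ^ d • (1 : Matrix (Fin 2) (Fin 2) ℝ[X]) + (X : ℝ[X]) ^ e • S₂.map C)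
      ).roots.toFinset.filter (fun x => 0 < x)).card) :
    ∃ r : Fin 5 → ℝ, StrictMono r ∧ (∀ i, 0 < r i) ∧
      (∀ i, (Matrix.det (S₀.map C + (X : ℝ[X]) ^ d • (1 : Matrix (Fin 2) (Fin 2) ℝ[X]) + (X : ℝ[X]) ^ e • S₂.map C)
        ).eval (r i) = 0) ∧
      (∀ z, 0 < z → z < r 0 → (Matrix.det (S₀.map C + (X : ℝ[X]) ^ d • (1 : Matrix (Fin 2) (Fin 2) ℝ[X])
        + (X : ℝ[X]) ^ e • S₂.map C)).eval z ≠ 0) ∧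
      (∀ (i : Fin 5) (z : ℝ), r i < z → (∀ j : Fin 5, i < j → z < r j) → (Matrix.det (S₀.map C
        + (X : ℝ[X]) ^ d • (1 : Matrix (Fin 2) (Fin 2) ℝ[X]) + (X : ℝ[X]) ^ e • S₂.map C)).eval z ≠ 0) ∧
      (let P := Matrix.det (S₀.map C + (X : ℝ[X]) ^ d • (1 : Matrix (Fin 2) (Fin 2) ℝ[X]) + (X : ℝ[X]) ^ e • S₂.map C)
       P.eval (r 0 / 2) * P.eval ((r 0 + r 1) / 2) < 0 ∧ P.eval ((r 0 + r 1) / 2) * P.eval ((r 1 + r 2) / 2) < 0 ∧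
       P.eval ((r 1 + r 2) / 2) * P.eval ((r 2 + r 3) / 2) < 0 ∧ P.eval ((r 2 + r 3) / 2) * P.eval ((r 3 + r 4) / 2) < 0 ∧
       P.eval ((r 3 + r 4) / 2) * P.eval (r 4 + 1) < 0) ∧
      S₀ 0 0 * S₀ 1 1 - S₀ 0 1 ^ 2 ≠ 0 ∧ S₂ 0 0 * S₂ 1 1 - S₂ 0 1 ^ 2 ≠ 0 := by
  classical
  set Pm := Matrix.det (S₀.map C + (X : ℝ[X]) ^ d • (1 : Matrix (Fin 2) (Fin 2) ℝ[X]) + (X : ℝ[X]) ^ e • S₂.map C)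
    with hPm
  set T := Pm.roots.toFinset.filter (fun x => 0 < x) with hTdef
  have he : 0 < e := lt_trans hd hde
  -- ### the pencil value, its determinant and entries
  have h10 : S₀ 1 0 = S₀ 0 1 := hS₀.apply 0 1
  have h10' : S₂ 1 0 = S₂ 0 1 := hS₂.apply 0 1
  have hFsym : ∀ x : ℝ, (S₀ + x ^ d • (1 : Matrix (Fin 2) (Fin 2) ℝ) + x ^ e • S₂) 1 0
      = (S₀ + x ^ d • (1 : Matrix (Fin 2) (Fin 2) ℝ) + x ^ e • S₂) 0 1 := by
    intro x; rw [pencil_apply, pencil_apply, h10]; simp [h10']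
  have hev : ∀ x, Pm.eval x = (S₀ + x ^ d • (1 : Matrix (Fin 2) (Fin 2) ℝ) + x ^ e • S₂).det :=
    fun x => by rw [hPm]; exact eval_det_pencilPoly S₀ S₂ d e x
  have hdet : ∀ x : ℝ, (S₀ + x ^ d • (1 : Matrix (Fin 2) (Fin 2) ℝ) + x ^ e • S₂).det
      = (S₀ + x ^ d • (1 : Matrix (Fin 2) (Fin 2) ℝ) + x ^ e • S₂) 0 0
          * (S₀ + x ^ d • (1 : Matrix (Fin 2) (Fin 2) ℝ) + x ^ e • S₂) 1 1
        - (S₀ + x ^ d • (1 : Matrix (Fin 2) (Fin 2) ℝ) + x ^ e • S₂) 0 1 ^ 2 := by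
    intro x; rw [Matrix.det_fin_two, hFsym, sq]
  -- ### Descartes: six monomials, so the five roots are simple and there are no others
  have hPexp : Pm = C (S₀ 0 0 * S₀ 1 1 - S₀ 0 1 ^ 2) * X ^ 0 + C (S₀ 0 0 + S₀ 1 1) * X ^ d + C 1 * X ^ (2 * d)
      + C (S₀ 0 0 * S₂ 1 1 + S₀ 1 1 * S₂ 0 0 - 2 * (S₀ 0 1 * S₂ 0 1)) * X ^ e + C (S₂ 0 0 + S₂ 1 1) * X ^ (d + e)
      + C (S₂ 0 0 * S₂ 1 1 - S₂ 0 1 ^ 2) * X ^ (2 * e) := by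
    apply Polynomial.funext
    intro x
    rw [hev, det_pencil_eq S₀ S₂ hS₀ hS₂]
    simp only [eval_add, eval_mul, eval_C, eval_pow, eval_X]
  have hsub : Pm.support ⊆ {0, d, 2 * d, e, d + e, 2 * e} := by
    intro k hk
    rw [mem_support_iff] at hk
    by_contra hk'
    simp only [Finset.mem_insert, Finset.mem_singleton, not_or] at hk'
    apply hk
    rw [hPexp]
    simp only [coeff_add, coeff_C_mul_X_pow, hk'.1, hk'.2.1, hk'.2.2.1, hk'.2.2.2.1, hk'.2.2.2.2.1, hk'.2.2.2.2.2,
      if_false, add_zero]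
  have hsupp : Pm.support.card ≤ 6 := (Finset.card_le_card hsub).trans Finset.card_le_six
  have hPev : ∀ x, Pm.eval x = (S₀ 0 0 * S₀ 1 1 - S₀ 0 1 ^ 2) * x ^ 0 + (S₀ 0 0 + S₀ 1 1) * x ^ d
      + 1 * x ^ (2 * d) + (S₀ 0 0 * S₂ 1 1 + S₀ 1 1 * S₂ 0 0 - 2 * (S₀ 0 1 * S₂ 0 1)) * x ^ e
      + (S₂ 0 0 + S₂ 1 1) * x ^ (d + e) + (S₂ 0 0 * S₂ 1 1 - S₂ 0 1 ^ 2) * x ^ (2 * e) := fun x => by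
    rw [hev]; exact det_pencil_eq S₀ S₂ hS₀ hS₂ d e x
  have hP0 : Pm ≠ 0 := by
    intro h0
    have : T.card = 0 := by rw [hTdef, h0]; simp
    omega
  have hM : (Pm.roots.filter (fun x => 0 < x)).card ≤ 5 := by
    have h1 := Pm.roots_countP_pos_le_signVariations
    have h2 := Literature.Computability.AlgebraicComplexity.signVariations_lt_card_support hP0
    rw [Multiset.countP_eq_card_filter] at h1
    omega
  have hTM : T = (Pm.roots.filter (fun x => 0 < x)).toFinset := by rw [hTdef, Multiset.toFinset_filter]
  have hTle : T.card ≤ (Pm.roots.filter (fun x => 0 < x)).card := by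
    rw [hTM]; exact Multiset.toFinset_card_le _
  have hT5 : T.card = 5 := le_antisymm (le_trans hTle hM) h5'
  have hnodup : (Pm.roots.filter (fun x => 0 < x)).Nodup := by
    rw [← Multiset.toFinset_card_eq_card_iff_nodup, ← hTM]
    exact le_antisymm (by rw [hTM]; exact Multiset.toFinset_card_le _) (by rw [hT5]; exact hM)
  have hmemT : ∀ x, x ∈ T ↔ 0 < x ∧ Pm.IsRoot x := by
    intro x
    rw [hTdef, Finset.mem_filter, Multiset.mem_toFinset, mem_roots hP0]
    tauto
  have hmult : ∀ x, x ∈ T → Pm.rootMultiplicity x = 1 := by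
    intro x hx
    obtain ⟨hxpos, hxroot⟩ := (hmemT x).mp hx
    have hc := Multiset.nodup_iff_count_le_one.mp hnodup x
    rw [Multiset.count_filter_of_pos hxpos, count_roots] at hc
    have h1 : 1 ≤ Pm.rootMultiplicity x := by
      rw [← count_roots, Multiset.one_le_count_iff_mem]; exact (mem_roots hP0).mpr hxroot
    omega
  -- ### sorted roots `r 0 < ⋯ < r 4`, all of them
  set r : Fin 5 ↪o ℝ := T.orderEmbOfFin hT5 with hr
  have hrT : ∀ i, r i ∈ T := fun i => Finset.orderEmbOfFin_mem T hT5 i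
  have hrpos : ∀ i, 0 < r i := fun i => ((hmemT _).mp (hrT i)).1
  have hrroot : ∀ i, Pm.eval (r i) = 0 := fun i => ((hmemT _).mp (hrT i)).2
  have hrmono : StrictMono r := r.strictMono
  have hall : ∀ x, 0 < x → Pm.eval x = 0 → ∃ i, r i = x := by
    intro x hx h0
    have hxT : x ∈ (T : Set ℝ) := (hmemT x).mpr ⟨hx, h0⟩
    rw [← Finset.range_orderEmbOfFin T hT5] at hxT
    exact hxT
  -- no roots strictly between consecutive `r`'s, below `r 0`, above `r 4`
  have hnz : ∀ z, 0 < z → (∀ i, r i ≠ z) → Pm.eval z ≠ 0 := fun z hz hne h0 => by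
    obtain ⟨i, hi⟩ := hall z hz h0; exact hne i hi
  have hgap : ∀ (i : Fin 5) (z : ℝ), r i < z → (∀ j : Fin 5, i < j → z < r j) → Pm.eval z ≠ 0 := by
    intro i z hz hup
    refine hnz z (lt_trans (hrpos i) hz) (fun j hj => ?_)
    rcases lt_trichotomy j i with hji | hji | hji
    · have := hrmono hji; rw [hj] at this; exact lt_irrefl _ (lt_trans this hz)
    · rw [hji] at hj; rw [hj] at hz; exact lt_irrefl _ hz
    · have := hup j hji; rw [hj] at this; exact lt_irrefl _ this
  have hgap0 : ∀ z : ℝ, 0 < z → z < r 0 → Pm.eval z ≠ 0 := by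
    intro z hz hz0
    refine hnz z hz (fun j hj => ?_)
    have : r 0 ≤ r j := hrmono.monotone (Fin.zero_le j)
    rw [hj] at this; exact lt_irrefl _ (lt_of_lt_of_le hz0 this)
  -- ### sample points: m 0 ∈ (0, r 0), m (i+1) ∈ (r i, r (i+1)), m 5 > r 4
  set m : Fin 6 → ℝ := ![r 0 / 2, (r 0 + r 1) / 2, (r 1 + r 2) / 2, (r 2 + r 3) / 2, (r 3 + r 4) / 2, r 4 + 1]
    with hm
  have h01 := hrmono (show (0 : Fin 5) < 1 by decide)
  have h12 := hrmono (show (1 : Fin 5) < 2 by decide)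
  have h23 := hrmono (show (2 : Fin 5) < 3 by decide)
  have h34 := hrmono (show (3 : Fin 5) < 4 by decide)
  have hr0 := hrpos 0
  have hcontP : Continuous fun x => Pm.eval x := Pm.continuous
  -- ### gap lemmas: no root in (0, r 0), (r i, r (i+1)), (r 4, ∞)
  have hg1 : ∀ z, r 0 < z → z < r 1 → Pm.eval z ≠ 0 := fun z h1 h2 =>
    hgap 0 z h1 (fun j hj => lt_of_lt_of_le h2 (hrmono.monotone (by omega)))
  have hg2 : ∀ z, r 1 < z → z < r 2 → Pm.eval z ≠ 0 := fun z h1 h2 =>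
    hgap 1 z h1 (fun j hj => lt_of_lt_of_le h2 (hrmono.monotone (by omega)))
  have hg3 : ∀ z, r 2 < z → z < r 3 → Pm.eval z ≠ 0 := fun z h1 h2 =>
    hgap 2 z h1 (fun j hj => lt_of_lt_of_le h2 (hrmono.monotone (by omega)))
  have hg4 : ∀ z, r 3 < z → z < r 4 → Pm.eval z ≠ 0 := fun z h1 h2 =>
    hgap 3 z h1 (fun j hj => lt_of_lt_of_le h2 (hrmono.monotone (by omega)))
  have hg5 : ∀ z, r 4 < z → Pm.eval z ≠ 0 := fun z h1 =>
    hgap 4 z h1 (fun j hj => absurd hj (by omega))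
  -- constant sign on each gap, relative to its sample point
  have hm0 : m 0 = r 0 / 2 := rfl
  have hm1 : m 1 = (r 0 + r 1) / 2 := rfl
  have hm2 : m 2 = (r 1 + r 2) / 2 := rfl
  have hm3 : m 3 = (r 2 + r 3) / 2 := rfl
  have hm4 : m 4 = (r 3 + r 4) / 2 := rfl
  have hm5 : m 5 = r 4 + 1 := rfl
  have same0 : ∀ x, 0 < x → x < r 0 → 0 < Pm.eval x * Pm.eval (m 0) := by
    intro x hx hx'
    rcases le_total x (m 0) with h | h
    · exact same_sign_of_no_zero hcontP h (fun z hz1 hz2 => hgap0 z (by linarith) (by rw [hm0] at hz2; linarith))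
    · rw [mul_comm]
      exact same_sign_of_no_zero hcontP h (fun z hz1 hz2 => hgap0 z (by rw [hm0] at hz1; linarith) (by linarith))
  have same1 : ∀ x, r 0 < x → x < r 1 → 0 < Pm.eval x * Pm.eval (m 1) := by
    intro x hx hx'
    rcases le_total x (m 1) with h | h
    · exact same_sign_of_no_zero hcontP h (fun z hz1 hz2 => hg1 z (by linarith) (by rw [hm1] at hz2; linarith))
    · rw [mul_comm]
      exact same_sign_of_no_zero hcontP h (fun z hz1 hz2 => hg1 z (by rw [hm1] at hz1; linarith) (by linarith))
  have same2 : ∀ x, r 1 < x → x < r 2 → 0 < Pm.eval x * Pm.eval (m 2) := by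
    intro x hx hx'
    rcases le_total x (m 2) with h | h
    · exact same_sign_of_no_zero hcontP h (fun z hz1 hz2 => hg2 z (by linarith) (by rw [hm2] at hz2; linarith))
    · rw [mul_comm]
      exact same_sign_of_no_zero hcontP h (fun z hz1 hz2 => hg2 z (by rw [hm2] at hz1; linarith) (by linarith))
  have same3 : ∀ x, r 2 < x → x < r 3 → 0 < Pm.eval x * Pm.eval (m 3) := by
    intro x hx hx'
    rcases le_total x (m 3) with h | h
    · exact same_sign_of_no_zero hcontP h (fun z hz1 hz2 => hg3 z (by linarith) (by rw [hm3] at hz2; linarith))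
    · rw [mul_comm]
      exact same_sign_of_no_zero hcontP h (fun z hz1 hz2 => hg3 z (by rw [hm3] at hz1; linarith) (by linarith))
  have same4 : ∀ x, r 3 < x → x < r 4 → 0 < Pm.eval x * Pm.eval (m 4) := by
    intro x hx hx'
    rcases le_total x (m 4) with h | h
    · exact same_sign_of_no_zero hcontP h (fun z hz1 hz2 => hg4 z (by linarith) (by rw [hm4] at hz2; linarith))
    · rw [mul_comm]
      exact same_sign_of_no_zero hcontP h (fun z hz1 hz2 => hg4 z (by rw [hm4] at hz1; linarith) (by linarith))
  have same5 : ∀ x, r 4 < x → 0 < Pm.eval x * Pm.eval (m 5) := by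
    intro x hx
    rcases le_total x (m 5) with h | h
    · exact same_sign_of_no_zero hcontP h (fun z hz1 hz2 => hg5 z (by linarith))
    · rw [mul_comm]
      exact same_sign_of_no_zero hcontP h (fun z hz1 hz2 => hg5 z (by rw [hm5] at hz1; linarith))
  -- ### alternation across each (simple) root
  have flip : ∀ (i : Fin 5) (lo hi : ℝ), lo < r i → r i < hi →
      (∀ x, lo < x → x < r i → 0 < Pm.eval x * Pm.eval ((lo + r i) / 2)) →
      (∀ x, r i < x → x < hi → 0 < Pm.eval x * Pm.eval ((r i + hi) / 2)) →
      Pm.eval ((lo + r i) / 2) * Pm.eval ((r i + hi) / 2) < 0 := by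
    intro i lo hi hlo hhi hleft hright
    obtain ⟨η, hη, hflip⟩ := sign_flip_of_simple_root Pm hP0 (hrroot i) (hmult _ (hrT i))
    set t := min (η / 2) (min ((r i - lo) / 2) ((hi - r i) / 2)) with ht
    have ht1 : t ≤ η / 2 := min_le_left _ _
    have ht2 : t ≤ (r i - lo) / 2 := le_trans (min_le_right _ _) (min_le_left _ _)
    have ht3 : t ≤ (hi - r i) / 2 := le_trans (min_le_right _ _) (min_le_right _ _)
    have htpos : 0 < t := lt_min (by linarith) (lt_min (by linarith) (by linarith))
    have h1 := hflip t htpos (by linarith)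
    have h2 := hleft (r i - t) (by linarith) (by linarith)
    have h3 := hright (r i + t) (by linarith) (by linarith)
    rw [mul_comm] at h2
    exact sgn_chain_neg h2 h1 h3
  have alt01 : Pm.eval (m 0) * Pm.eval (m 1) < 0 := by
    have := flip 0 0 (r 1) hr0 h01 (fun x hx hx' => by
      have h := same0 x hx hx'; rwa [hm0, show r 0 / 2 = (0 + r 0) / 2 by ring] at h) (fun x hx hx' => same1 x hx hx')
    rwa [hm0, hm1, show r 0 / 2 = (0 + r 0) / 2 by ring]
  have alt12 : Pm.eval (m 1) * Pm.eval (m 2) < 0 :=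
    flip 1 (r 0) (r 2) h01 h12 (fun x hx hx' => same1 x hx hx') (fun x hx hx' => same2 x hx hx')
  have alt23 : Pm.eval (m 2) * Pm.eval (m 3) < 0 :=
    flip 2 (r 1) (r 3) h12 h23 (fun x hx hx' => same2 x hx hx') (fun x hx hx' => same3 x hx hx')
  have alt34 : Pm.eval (m 3) * Pm.eval (m 4) < 0 :=
    flip 3 (r 2) (r 4) h23 h34 (fun x hx hx' => same3 x hx hx') (fun x hx hx' => same4 x hx hx')
  have alt45 : Pm.eval (m 4) * Pm.eval (m 5) < 0 := by
    have := flip 4 (r 3) (r 4 + 2) h34 (by linarith) (fun x hx hx' => same4 x hx hx') (fun x hx _ => by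
      have h := same5 x hx; rwa [hm5, show r 4 + 1 = (r 4 + (r 4 + 2)) / 2 by ring] at h)
    rwa [hm4, hm5, show r 4 + 1 = (r 4 + (r 4 + 2)) / 2 by ring]
  -- ### all six monomials are present: the end letters are nonsingular
  have hfull : Pm.support = {0, d, 2 * d, e, d + e, 2 * e} := by
    refine Finset.eq_of_subset_of_card_le hsub ?_
    have h := Literature.Computability.AlgebraicComplexity.card_roots_toFinset_filter_pos_lt_card_support hP0
    rw [← hTdef] at h
    have h6 : ({0, d, 2 * d, e, d + e, 2 * e} : Finset ℕ).card ≤ 6 := Finset.card_le_six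
    omega
  have hc0 : Pm.coeff 0 ≠ 0 := mem_support_iff.mp (by rw [hfull]; simp)
  have hc2e : Pm.coeff (2 * e) ≠ 0 := mem_support_iff.mp (by rw [hfull]; simp)
  have hcoeff0 : Pm.coeff 0 = S₀ 0 0 * S₀ 1 1 - S₀ 0 1 ^ 2 := by
    rw [hPexp]
    simp only [coeff_add, coeff_C_mul_X_pow]
    have h1 : (0:ℕ) ≠ d := by omega
    have h2 : (0:ℕ) ≠ 2 * d := by omega
    have h3 : (0:ℕ) ≠ e := by omega
    have h4 : (0:ℕ) ≠ d + e := by omega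
    have h5 : (0:ℕ) ≠ 2 * e := by omega
    simp [h1, h2, h3, h4, h5]
  have hcoeff2e : Pm.coeff (2 * e) = S₂ 0 0 * S₂ 1 1 - S₂ 0 1 ^ 2 := by
    rw [hPexp]
    simp only [coeff_add, coeff_C_mul_X_pow]
    have h1 : 2 * e ≠ 0 := by omega
    have h2 : 2 * e ≠ d := by omega
    have h3 : 2 * e ≠ 2 * d := by omega
    have h4 : 2 * e ≠ e := by omega
    have h5 : 2 * e ≠ d + e := by omega
    simp [h1, h2, h3, h4, h5]
  refine ⟨r, hrmono, hrpos, hrroot, hgap0, hgap, ?_, by rw [← hcoeff0]; exact hc0, by rw [← hcoeff2e]; exact hc2e⟩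
  simp only []
  rw [hm0, hm1] at alt01
  rw [hm1, hm2] at alt12
  rw [hm2, hm3] at alt23
  rw [hm3, hm4] at alt34
  rw [hm4, hm5] at alt45
  exact ⟨alt01, alt12, alt23, alt34, alt45⟩

end Summit.ValiantsHypothesis.ValiantsHypothesis.Theorems.LacunarySymmetroidMatrixDescartes.Census.DefiniteMiddle
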